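import Literature.Probability.Distributions.LogConcaveSequences
import Literature.Probability.Distributions.PoissonBinomialRecursion
import HarnessLib

/-!
# Poisson-binomial laws are log-concave and unimodal; the total variation of their first
# difference is twice the mode probability, and the mode probability is `O(Var^{-1/2})`

Elementary (measure-free) facts about the law `q = (q_i)_i` of a sum `W` of independent Bernoulli
variables with parameters `p_1, …, p_N ∈ [0,1]` (a *Poisson-binomial* law), in the table form
`PoissonBinomial.pmf ps` of `PoissonBinomialRecursion.lean` (Lange's recursion), and about
log-concave sequences without internal zeros (`IsLogConcaveSeq`, `LogConcaveSequences.lean`):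

* §1 `pmf_cons_eq_seqConv`, **`isLogConcaveSeq_pmf`** — one step of the recursion is a convolution
  with the Bernoulli weights `(1 − p, p)`, hence the law is `PF₂` (log-concave, no internal zeros)
  [Karlin 1968, Ch. 8 §1: `PF₂` is closed under convolution; tree `isLogConcaveSeq_seqConv`].
* §2 `IsLogConcaveSeq.monotone_of_le_argmax` / `antitone_of_argmax_le` — a `PF₂` sequence is
  UNIMODAL (non-decreasing up to any maximiser, non-increasing after it), and
  **`IsLogConcaveSeq.sum_abs_sub_eq_two_mul`** — for a finitely supported `PF₂` sequence the total
  variation of the first difference is twice the maximum: `f 0 + Σ_{i ≤ M} |f (i+1) − f i| = 2 · max f`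
  [Karlin 1968, Ch. 8 §1 (unimodality of `PF₂` sequences); the identity is the telescoping sum].
* §3 **`IsLogConcaveSeq.sq_mul_variance_le`** — ANTI-CONCENTRATION: for a `PF₂` probability
  sequence with maximum `μ*` and variance `V`, `μ*² · V ≤ 192`, i.e. `μ* ≤ √192 / √V`; proof: the
  tail `j ↦ f(m+j)` from a maximiser `m` is non-increasing and sub-multiplicative
  (`f(m)·f(m+i+j) ≤ f(m+i)·f(m+j)`), so with `L = min{j : f(m+j) ≤ μ*/2}` one has `L < 2/μ*` (mass)
  and `f(m+qL+s) ≤ μ*·2^{−q}` (decay), whence `Σ_j j² f(m+j) ≤ 12 μ* L³ ≤ 96/μ*²`; both tails give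
  `V ≤ Σ_i (i − m)² f_i ≤ 192/μ*²` — a weak form of Bobkov–Marsiglietti–Melbourne 2021, Thm 1.1
  (`M(X) ≤ 2/√(1 + 4 Var X)` for every discrete log-concave `X`; the sharp constant is not needed
  downstream and not formalised).
* §4 **`PoissonBinomial.pmf_le_of_variance`**, **`PoissonBinomial.tv_pmf_le_of_variance`** — for a
  Poisson-binomial law with `V = Σ_k p_k(1 − p_k) > 0`: `max_i q_i ≤ √192/√V` and
  `q_0 + Σ_i |q_{i+1} − q_i| ≤ 2√192/√V` [Röllin–Ross 2015, §3 (the smoothness measure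
  `D_1(L(W)) = ‖Δ L(W)‖`); the `V^{−1/2}` rate is Mattner–Roos 2007 Cor. 1.6 with a sharp constant —
  here with the crude constant from §3, which is all that is used downstream].

Purely algebraic: finite sums over `ℝ`, no measure theory (the identification with random variables is
`LeCamInequality.lean`'s business). Cell pnp-psdrank (LIT-44 §5 (c3), prover g21): this is the
`x`-smoothness input for the shell laws of block statistics; the higher differences
`‖Δ^k L(W)‖ ≤ (Ck/V)^{k/2}` (Röllin–Ross Lemma 3.4 + blocks) are in the companion file
`PoissonBinomialDifferences.lean`.

## References
* [Karlin1968] S. Karlin, *Total Positivity I* (1968), Ch. 8 §1.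
* [Lange2010] K. Lange, *Numerical Analysis for Statisticians* (2010), §1.7 eq. (1.4).
* [BobkovMarsigliettiMelbourne2021] S. G. Bobkov, A. Marsiglietti, J. Melbourne, *Concentration
  functions and entropy bounds for discrete log-concave distributions*, Combin. Probab. Comput. 31
  (2022) 54–72, Thm 1.1.
* [RollinRoss2010] A. Röllin, N. Ross, *Local limit theorems via Landau–Kolmogorov inequalities*,
  Bernoulli 21 (2015) 851–880, §3 (Lemma 3.1–3.5), §4.1 (Thm 4.2).
-/

namespace Literature.Probability.Distributions

open Finset

/-! ## §1 Poisson-binomial laws are `PF₂` -/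

namespace PoissonBinomial

/-- The Bernoulli weights `(1 − p, p, 0, 0, …)` as a sequence on `ℕ`. [cite: Lange2010, §1.7 eq. (1.4)] -/
theorem bernoulliSeq_apply (p : ℝ) (k : ℕ) :
    (fun k : ℕ => if k = 0 then 1 - p else if k = 1 then p else (0 : ℝ)) k =
      if k = 0 then 1 - p else if k = 1 then p else 0 := rfl

/-- **One step of Lange's recursion is a convolution with the Bernoulli weights**:
`q_{p::ps} = (1−p, p) ⋆ q_{ps}`. [cite: Lange2010, §1.7 eq. (1.4)] -/
theorem pmf_cons_eq_seqConv (p : ℝ) (ps : List ℝ) (i : ℕ) :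
    pmf (p :: ps) i = seqConv (fun k : ℕ => if k = 0 then 1 - p else if k = 1 then p else (0 : ℝ)) (pmf ps) i := by
  rcases i with _ | i
  · simp [seqConv]
  · rw [pmf_cons_succ, seqConv, sum_range_succ', sum_range_succ']
    rw [sum_eq_zero (fun k _ => by simp)]
    simp only [zero_add, if_neg (Nat.succ_ne_zero _), if_true, Nat.sub_zero,
      show i + 1 - (0 + 1) = i by omega]

/-- **A Poisson-binomial law is log-concave without internal zeros** (`PF₂`), for parameters in `[0,1]`.
[cite: Karlin1968, Ch. 8 §1] -/
theorem isLogConcaveSeq_pmf : ∀ ps : List ℝ, (∀ p ∈ ps, 0 ≤ p ∧ p ≤ 1) → IsLogConcaveSeq (pmf ps)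
  | [], _ => by
    have h : pmf [] = fun n => if n = 0 then (1 : ℝ) else 0 := by
      funext n; rcases n with _ | n <;> simp
    rw [h]; exact isLogConcaveSeq_delta zero_le_one
  | p :: ps, h => by
    have hp := h p (by simp)
    have ih := isLogConcaveSeq_pmf ps (fun q hq => h q (by simp [hq]))
    have hfun : pmf (p :: ps) =
        seqConv (fun k : ℕ => if k = 0 then 1 - p else if k = 1 then p else (0 : ℝ)) (pmf ps) := by
      funext i; exact pmf_cons_eq_seqConv p ps i
    rw [hfun]
    refine isLogConcaveSeq_seqConv (isLogConcaveSeq_of_support_subset_zero_one ?_ ?_) ih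
    · intro n
      split_ifs
      · linarith [hp.2]
      · exact hp.1
      · exact le_rfl
    · intro n hn
      rw [if_neg (by omega), if_neg (by omega)]

end PoissonBinomial

/-! ## §2 `PF₂` sequences are unimodal; total variation of the first difference -/

namespace IsLogConcaveSeq

variable {f : ℕ → ℝ}

/-- Ratio monotonicity of a `PF₂` sequence: `f i · f (j+1) ≤ f (i+1) · f j` for `i ≤ j`.
[cite: Karlin1968, Ch. 8 §1] -/
theorem mul_succ_le (hf : IsLogConcaveSeq f) {i j : ℕ} (hij : i ≤ j) : f i * f (j + 1) ≤ f (i + 1) * f j :=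
  hf.2 (by omega) (by omega) (by omega)

/-- A strict rise propagates to the left: if `f j < f (j+1)` then `f i ≤ f (i+1)` for every `i ≤ j`.
[cite: Karlin1968, Ch. 8 §1] -/
theorem le_succ_of_lt_succ (hf : IsLogConcaveSeq f) {i j : ℕ} (hij : i ≤ j) (hj : f j < f (j + 1)) :
    f i ≤ f (i + 1) := by
  by_contra hlt
  rw [not_le] at hlt
  have h := hf.mul_succ_le hij
  have h0j : 0 ≤ f j := hf.1 j
  have h0i : 0 ≤ f (i + 1) := hf.1 (i + 1)
  -- `f i · f (j+1) > f (i+1) · f j`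
  have : f (i + 1) * f j < f i * f (j + 1) := by
    calc f (i + 1) * f j ≤ f (i + 1) * f (j + 1) := mul_le_mul_of_nonneg_left hj.le h0i
      _ < f i * f (j + 1) := mul_lt_mul_of_pos_right hlt (lt_of_le_of_lt h0j hj)
  exact absurd h (not_le.2 this)

/-- A strict fall propagates to the right: if `f (i+1) < f i` then `f (j+1) ≤ f j` for every `j ≥ i`.
[cite: Karlin1968, Ch. 8 §1] -/
theorem succ_le_of_succ_lt (hf : IsLogConcaveSeq f) {i j : ℕ} (hij : i ≤ j) (hi : f (i + 1) < f i) :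
    f (j + 1) ≤ f j := by
  by_contra hlt
  rw [not_le] at hlt
  exact absurd (hf.le_succ_of_lt_succ hij hlt) (not_le.2 hi)

/-- **Unimodality, rising part**: a `PF₂` sequence is non-decreasing on `[0, m]` for any maximiser `m`.
[cite: Karlin1968, Ch. 8 §1] -/
theorem monotone_of_le_argmax (hf : IsLogConcaveSeq f) {m : ℕ} (hm : ∀ n, f n ≤ f m) {i : ℕ} (hi : i < m) :
    f i ≤ f (i + 1) := by
  by_contra hlt
  rw [not_le] at hlt
  -- the fall at `i` propagates: `f (i+1+d) ≤ f (i+1)` for every `d`, in particular `f m ≤ f (i+1) < f i`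
  have hchain : ∀ d, f (i + 1 + d) ≤ f (i + 1) := by
    intro d
    induction d with
    | zero => simp
    | succ d ihd =>
        have hstep := hf.succ_le_of_succ_lt (show i ≤ i + 1 + d by omega) hlt
        rw [show i + 1 + (d + 1) = i + 1 + d + 1 by ring]
        exact hstep.trans ihd
  have h1 := hchain (m - (i + 1))
  rw [show i + 1 + (m - (i + 1)) = m by omega] at h1
  exact absurd ((hm i).trans h1) (not_le.2 hlt)

/-- **Unimodality, falling part**: a `PF₂` sequence is non-increasing on `[m, ∞)` for any maximiser `m`.
[cite: Karlin1968, Ch. 8 §1] -/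
theorem antitone_of_argmax_le (hf : IsLogConcaveSeq f) {m : ℕ} (hm : ∀ n, f n ≤ f m) {j : ℕ} (hj : m ≤ j) :
    f (j + 1) ≤ f j := by
  by_contra hlt
  rw [not_le] at hlt
  -- the rise at `j` propagates down to `m`: `f (m + d) ≤ f j < f (j+1)` ... in particular `f m ≤ f j`... and `f j < f (j+1) ≤ f m`
  have hchain : ∀ d, m + d ≤ j → f m ≤ f (m + d) := by
    intro d
    induction d with
    | zero => intro; simp
    | succ d ihd =>
        intro hd
        have hstep := hf.le_succ_of_lt_succ (show m + d ≤ j by omega) hlt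
        rw [show m + (d + 1) = m + d + 1 by ring]
        exact (ihd (by omega)).trans hstep
  have h1 := hchain (j - m) (by omega)
  rw [show m + (j - m) = j by omega] at h1
  exact absurd ((h1.trans_lt hlt).trans_le (hm (j + 1))) (lt_irrefl _)

/-- Chained form of the rising part: `f i ≤ f k` for `i ≤ k ≤ m`. [cite: Karlin1968, Ch. 8 §1] -/
theorem le_of_le_of_le_argmax (hf : IsLogConcaveSeq f) {m : ℕ} (hm : ∀ n, f n ≤ f m) {i k : ℕ} (hik : i ≤ k)
    (hkm : k ≤ m) : f i ≤ f k := by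
  obtain ⟨d, rfl⟩ : ∃ d, k = i + d := ⟨k - i, by omega⟩
  induction d with
  | zero => simp
  | succ d ihd =>
      rw [show i + (d + 1) = i + d + 1 by ring]
      exact (ihd (by omega) (by omega)).trans (hf.monotone_of_le_argmax hm (by omega))

/-- Chained form of the falling part: `f k ≤ f j` for `m ≤ j ≤ k`. [cite: Karlin1968, Ch. 8 §1] -/
theorem le_of_argmax_le_of_le (hf : IsLogConcaveSeq f) {m : ℕ} (hm : ∀ n, f n ≤ f m) {j k : ℕ} (hmj : m ≤ j)
    (hjk : j ≤ k) : f k ≤ f j := by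
  obtain ⟨d, rfl⟩ : ∃ d, k = j + d := ⟨k - j, by omega⟩
  induction d with
  | zero => simp
  | succ d ihd =>
      rw [show j + (d + 1) = j + d + 1 by ring]
      exact (hf.antitone_of_argmax_le hm (by omega)).trans (ihd (by omega))

/-- **Total variation of the first difference of a finitely supported `PF₂` sequence is twice its
maximum**: if `f n = 0` for `n > M` and `m` is a maximiser, then
`f 0 + Σ_{i ≤ M} |f (i+1) − f i| = 2 · f m` (the boundary term `f 0 = |f 0 − f (−1)|`).
[cite: RollinRoss2010, §3 (the smoothness measure `D_1`)] -/
theorem sum_abs_sub_eq_two_mul (hf : IsLogConcaveSeq f) {M m : ℕ} (hM : ∀ n, M < n → f n = 0)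
    (hm : ∀ n, f n ≤ f m) :
    f 0 + ∑ i ∈ range (M + 1), |f (i + 1) - f i| = 2 * f m := by
  -- we may assume `m ≤ M` (otherwise `f ≡ 0`... more precisely `f m = 0`, so `f = 0` everywhere)
  by_cases hmM : M < m
  · have hfm : f m = 0 := hM m hmM
    have hz : ∀ n, f n = 0 := fun n => le_antisymm (hfm ▸ hm n) (hf.1 n)
    simp [hz]
  rw [not_lt] at hmM
  -- split the sum at `m`: rising part telescopes to `f m − f 0`, falling part to `f m − f (M+1) = f m`
  rw [← sum_range_add_sum_Ico _ (show m ≤ M + 1 by omega)]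
  have hrise : ∑ i ∈ range m, |f (i + 1) - f i| = f m - f 0 := by
    rw [sum_congr rfl fun i hi => abs_of_nonneg (sub_nonneg.2 (hf.monotone_of_le_argmax hm (mem_range.1 hi)))]
    exact sum_range_sub f m
  have hfall : ∑ i ∈ Ico m (M + 1), |f (i + 1) - f i| = f m - f (M + 1) := by
    rw [sum_congr rfl fun i hi => by
      rw [abs_of_nonpos (sub_nonpos.2 (hf.antitone_of_argmax_le hm (mem_Ico.1 hi).1)), neg_sub]]
    rw [sum_Ico_eq_sum_range]
    have := sum_range_sub (fun i => -f (m + i)) (M + 1 - m)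
    simp only [neg_sub_neg, add_zero] at this
    rw [show m + (M + 1 - m) = M + 1 by omega] at this
    rw [← this]
    refine sum_congr rfl fun i _ => ?_
    rw [show m + (i + 1) = m + i + 1 by ring]
  rw [hrise, hfall, hM (M + 1) (by omega)]
  ring

end IsLogConcaveSeq


/-! ## §3 Anti-concentration: the maximum of a `PF₂` probability sequence is `O(Var^{-1/2})` -/

/-- `Σ_{q<Q} (q+1)²/2^q = 12 − (2Q² + 8Q + 12)/2^Q` (so the series sums to `12`). [folklore] -/
private theorem sum_sq_div_two_pow_eq (Q : ℕ) :
    ∑ q ∈ range Q, ((q : ℝ) + 1) ^ 2 / 2 ^ q = 12 - (2 * (Q : ℝ) ^ 2 + 8 * Q + 12) / 2 ^ Q := by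
  induction Q with
  | zero => simp
  | succ Q ih =>
      rw [sum_range_succ, ih, pow_succ]
      push_cast
      field_simp
      ring

/-- `Σ_{q<Q} (q+1)²/2^q ≤ 12`. [folklore] -/
private theorem sum_sq_div_two_pow_le (Q : ℕ) : ∑ q ∈ range Q, ((q : ℝ) + 1) ^ 2 / 2 ^ q ≤ 12 := by
  rw [sum_sq_div_two_pow_eq]
  have : 0 ≤ (2 * (Q : ℝ) ^ 2 + 8 * Q + 12) / 2 ^ Q := by positivity
  linarith

/-- **One-sided tail bound.** A nonnegative, non-increasing sequence `g` with `g 0 > 0`, the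
sub-multiplicativity `g 0 · g (i+j) ≤ g i · g j` of a log-concave tail, partial sums `≤ 1`, and which
eventually drops below `g 0 / 2`, has `Σ_{j<J} j² g j ≤ 96 / (g 0)²` for every `J`: with
`L = min {j : g j ≤ g 0/2}` one has `L ≤ 2/g 0` (mass) and `g (qL + s) ≤ g 0 · 2^{−q}` (decay), so the
sum is `≤ g 0 · L³ · Σ_q (q+1)² 2^{−q} ≤ 12 g 0 L³`. [folklore] -/
private theorem tail_sq_sum_le {g : ℕ → ℝ} (h0 : ∀ j, 0 ≤ g j) (hanti : ∀ ⦃i j⦄, i ≤ j → g j ≤ g i)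
    (hsub : ∀ i j, g 0 * g (i + j) ≤ g i * g j) (hmass : ∀ J, ∑ j ∈ range J, g j ≤ 1)
    (hvan : ∃ j, g j ≤ g 0 / 2) (hpos : 0 < g 0) (J : ℕ) :
    ∑ j ∈ range J, (j : ℝ) ^ 2 * g j ≤ 96 / g 0 ^ 2 := by
  classical
  set μ := g 0 with hμ
  -- `L` = first index where `g ≤ μ/2`
  let L : ℕ := Nat.find hvan
  have hL : g L ≤ μ / 2 := Nat.find_spec hvan
  have hLmin : ∀ j, j < L → μ / 2 < g j := fun j hj => lt_of_not_ge (Nat.find_min hvan hj)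
  have hL1 : 1 ≤ L := by
    rcases Nat.eq_zero_or_pos L with h | h
    · have := hL; rw [h] at this; linarith
    · exact h
  have hLpos : (0 : ℝ) < L := by exact_mod_cast hL1
  -- mass: `L · μ/2 ≤ 1`
  have hLμ : (L : ℝ) * (μ / 2) ≤ 1 := by
    have h1 : ∑ j ∈ range L, μ / 2 ≤ ∑ j ∈ range L, g j :=
      sum_le_sum fun j hj => (hLmin j (mem_range.1 hj)).le
    rw [sum_const, card_range, nsmul_eq_mul] at h1
    exact h1.trans (hmass L)
  have hLle : (L : ℝ) ≤ 2 / μ := by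
    rw [le_div_iff₀ hpos]; linarith
  -- decay: `g (q L) ≤ μ / 2^q`
  have hdec : ∀ q : ℕ, g (q * L) ≤ μ / 2 ^ q := by
    intro q
    induction q with
    | zero => simp [hμ]
    | succ q ih =>
        have h1 := hsub (q * L) L
        rw [show q * L + L = (q + 1) * L by ring] at h1
        -- `μ · g((q+1)L) ≤ g(qL) · g L ≤ (μ/2^q)(μ/2)`
        have h2 : g (q * L) * g L ≤ μ / 2 ^ q * (μ / 2) :=
          mul_le_mul ih hL (h0 L) (by positivity)
        have h3 : μ * g ((q + 1) * L) ≤ μ * (μ / 2 ^ (q + 1)) := by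
          calc μ * g ((q + 1) * L) ≤ μ / 2 ^ q * (μ / 2) := h1.trans h2
            _ = μ * (μ / 2 ^ (q + 1)) := by rw [pow_succ]; ring
        exact le_of_mul_le_mul_left h3 hpos
  -- block bound: `Σ_{j<QL} j² g j ≤ μ L³ Σ_{q<Q} (q+1)²/2^q`
  have hblock : ∀ Q : ℕ, ∑ j ∈ range (Q * L), (j : ℝ) ^ 2 * g j ≤
      μ * (L : ℝ) ^ 3 * ∑ q ∈ range Q, ((q : ℝ) + 1) ^ 2 / 2 ^ q := by
    intro Q
    induction Q with
    | zero => simp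
    | succ Q ih =>
        rw [show (Q + 1) * L = Q * L + L by ring, sum_range_add, sum_range_succ, mul_add]
        refine add_le_add ih ?_
        have hterm : ∀ x ∈ range L, ((Q * L + x : ℕ) : ℝ) ^ 2 * g (Q * L + x) ≤
            (((Q : ℝ) + 1) * L) ^ 2 * (μ / 2 ^ Q) := by
          intro x hx
          have hx' := mem_range.1 hx
          have hj : ((Q * L + x : ℕ) : ℝ) ≤ ((Q : ℝ) + 1) * L := by
            have : Q * L + x ≤ (Q + 1) * L := by nlinarith
            exact_mod_cast this
          have hg : g (Q * L + x) ≤ μ / 2 ^ Q := (hanti (Nat.le_add_right _ _)).trans (hdec Q)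
          exact mul_le_mul (pow_le_pow_left₀ (by positivity) hj 2) hg (h0 _) (by positivity)
        calc ∑ x ∈ range L, ((Q * L + x : ℕ) : ℝ) ^ 2 * g (Q * L + x)
            ≤ ∑ x ∈ range L, (((Q : ℝ) + 1) * L) ^ 2 * (μ / 2 ^ Q) := sum_le_sum hterm
          _ = μ * (L : ℝ) ^ 3 * (((Q : ℝ) + 1) ^ 2 / 2 ^ Q) := by
              rw [sum_const, card_range, nsmul_eq_mul]; ring
  -- conclude with `Q = J` (`J ≤ J L`)
  have hmono : ∑ j ∈ range J, (j : ℝ) ^ 2 * g j ≤ ∑ j ∈ range (J * L), (j : ℝ) ^ 2 * g j :=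
    sum_le_sum_of_subset_of_nonneg (range_subset_range.2 (Nat.le_mul_of_pos_right J hL1))
      (fun j _ _ => mul_nonneg (sq_nonneg _) (h0 j))
  refine hmono.trans ((hblock J).trans ?_)
  calc μ * (L : ℝ) ^ 3 * ∑ q ∈ range J, ((q : ℝ) + 1) ^ 2 / 2 ^ q
      ≤ μ * (2 / μ) ^ 3 * 12 := by
        refine mul_le_mul (mul_le_mul_of_nonneg_left (pow_le_pow_left₀ hLpos.le hLle 3) hpos.le)
          (sum_sq_div_two_pow_le J) (sum_nonneg fun q _ => by positivity) (by positivity)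
    _ = 96 / μ ^ 2 := by field_simp; ring

namespace IsLogConcaveSeq

variable {f : ℕ → ℝ}

/-- **Second moment about a maximiser**: for a `PF₂` sequence supported in `[0, M]` with partial sums
`≤ 1` and a maximiser `m` with `f m > 0`, `Σ_{n ≤ M} (n − m)² f n ≤ 192 / (f m)²` (the two tails from
`m` are log-concave, non-increasing and sub-multiplicative; `tail_sq_sum_le`). A weak form (constant
`192`, second moment about the mode) of the upper bound `M(X) ≤ 2/√(1 + 4 Var X)` of
[cite: BobkovMarsigliettiMelbourne2021, Thm 1.1 (upper bound; weak form, our elementary proof)]. -/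
theorem sum_sq_sub_mul_le (hf : IsLogConcaveSeq f) {M m : ℕ} (hM : ∀ n, M < n → f n = 0)
    (hm : ∀ n, f n ≤ f m) (hpos : 0 < f m) (hmass : ∑ n ∈ range (M + 1), f n ≤ 1) :
    ∑ n ∈ range (M + 1), ((n : ℝ) - m) ^ 2 * f n ≤ 192 / f m ^ 2 := by
  have hmM : m ≤ M := by
    by_contra h; rw [not_le] at h; exact absurd (hM m h) hpos.ne'
  -- partial sums of `f` over any range are `≤ 1`
  have hmass' : ∀ J, ∑ n ∈ range J, f n ≤ 1 := by
    intro J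
    rcases le_or_gt J (M + 1) with hJ | hJ
    · exact (sum_le_sum_of_subset_of_nonneg (range_subset_range.2 hJ) fun n _ _ => hf.1 n).trans hmass
    · rw [← sum_range_add_sum_Ico _ hJ.le,
        sum_eq_zero (s := Ico (M + 1) J) fun n hn => hM n (by have := (mem_Ico.1 hn).1; omega), add_zero]
      exact hmass
  -- RIGHT tail `g j = f (m + j)`
  have hright : ∑ j ∈ range (M + 1 - m), (j : ℝ) ^ 2 * f (m + j) ≤ 96 / f m ^ 2 := by
    have h := tail_sq_sum_le (g := fun j => f (m + j)) (fun j => hf.1 _)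
      (fun i j hij => hf.le_of_argmax_le_of_le hm (Nat.le_add_right m i) (by omega))
      (fun i j => by
        simpa [add_assoc] using hf.2 (show m ≤ m + i by omega) (show m + i ≤ m + (i + j) by omega)
          (show m + (m + (i + j)) = m + i + (m + j) by ring))
      (fun J => by
        have := hmass' (m + J)
        rw [sum_range_add] at this
        linarith [sum_nonneg fun n (_ : n ∈ range m) => hf.1 n])
      ⟨M + 1, by rw [hM (m + (M + 1)) (by omega)]; exact by simpa using (half_pos hpos).le⟩
      (by simpa using hpos) (M + 1 - m)
    simpa using h
  -- LEFT tail `g j = f (m − j)` for `j ≤ m`, `0` beyond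
  set g : ℕ → ℝ := fun j => if j ≤ m then f (m - j) else 0 with hg
  have hg0 : g 0 = f m := by simp [hg]
  have hgnonneg : ∀ j, 0 ≤ g j := fun j => by
    simp only [hg]; split_ifs
    · exact hf.1 _
    · exact le_rfl
  have hganti : ∀ ⦃i j⦄, i ≤ j → g j ≤ g i := by
    intro i j hij
    simp only [hg]
    split_ifs with hj hi
    · exact hf.le_of_le_of_le_argmax hm (by omega) (by omega)
    · omega
    · exact hf.1 _
    · exact le_rfl
  have hgsub : ∀ i j, g 0 * g (i + j) ≤ g i * g j := by
    intro i j
    rw [hg0]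
    simp only [hg]
    split_ifs with hij hi hj hj
    · -- `f m · f (m−i−j) ≤ f (m−i) · f (m−j)`
      have := hf.2 (show m - (i + j) ≤ m - j by omega) (show m - j ≤ m by omega)
        (show m - (i + j) + m = m - j + (m - i) by omega)
      linarith [mul_comm (f (m - j)) (f (m - i)), mul_comm (f (m - (i + j))) (f m)]
    · omega
    · omega
    · omega
    · rw [mul_zero]; exact mul_nonneg (hf.1 _) (hf.1 _)
    · rw [mul_zero, mul_zero]
    · rw [mul_zero, zero_mul]
    · rw [mul_zero, mul_zero]
  have hgmass : ∀ J, ∑ j ∈ range J, g j ≤ 1 := by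
    intro J
    -- `Σ_{j<J} g j ≤ Σ_{j ≤ m} g j = Σ_{n ≤ m} f n ≤ 1`
    have h1 : ∑ j ∈ range J, g j ≤ ∑ j ∈ range (m + 1), g j := by
      rcases le_or_gt J (m + 1) with hJ | hJ
      · exact sum_le_sum_of_subset_of_nonneg (range_subset_range.2 hJ) fun j _ _ => hgnonneg j
      · rw [← sum_range_add_sum_Ico _ hJ.le, sum_eq_zero (s := Ico (m + 1) J) fun j hj => by
          simp only [hg]; rw [if_neg (by have := (mem_Ico.1 hj).1; omega)], add_zero]
    have h2 : ∑ j ∈ range (m + 1), g j = ∑ n ∈ range (m + 1), f n := by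
      rw [← sum_range_reflect]
      refine sum_congr rfl fun j hj => ?_
      have hj' := mem_range.1 hj
      simp only [hg]
      rw [if_pos (by omega), show m - (m + 1 - 1 - j) = j by omega]
    exact h1.trans (h2 ▸ hmass' (m + 1))
  have hleft : ∑ j ∈ range (m + 1), (j : ℝ) ^ 2 * g j ≤ 96 / f m ^ 2 := by
    have h := tail_sq_sum_le hgnonneg hganti hgsub hgmass
      ⟨m + 1, by
        have h1 : g (m + 1) = 0 := by simp [hg]
        rw [h1, hg0]; exact (half_pos hpos).le⟩ (by rw [hg0]; exact hpos)
      (m + 1)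
    rwa [hg0] at h
  -- assemble: split the sum at `m`
  rw [← sum_range_add_sum_Ico _ (show m ≤ M + 1 by omega)]
  have hL : ∑ n ∈ range m, ((n : ℝ) - m) ^ 2 * f n ≤ ∑ j ∈ range (m + 1), (j : ℝ) ^ 2 * g j := by
    rw [sum_range_succ', ← sum_range_reflect]
    simp only [Nat.cast_zero, ne_eq, OfNat.ofNat_ne_zero, not_false_eq_true, zero_pow, zero_mul, add_zero]
    refine (sum_congr rfl fun j hj => ?_).le
    have hj' := mem_range.1 hj
    simp only [hg]
    rw [if_pos (by omega), show m - (j + 1) = m - 1 - j by omega]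
    have : ((m - 1 - j : ℕ) : ℝ) - m = -((j : ℝ) + 1) := by
      rw [Nat.cast_sub (by omega), Nat.cast_sub (by omega)]; push_cast; ring
    rw [this]; push_cast; ring
  have hR : ∑ n ∈ Ico m (M + 1), ((n : ℝ) - m) ^ 2 * f n = ∑ j ∈ range (M + 1 - m), (j : ℝ) ^ 2 * f (m + j) := by
    rw [sum_Ico_eq_sum_range]
    refine sum_congr rfl fun j _ => ?_
    push_cast; ring
  calc ∑ n ∈ range m, ((n : ℝ) - m) ^ 2 * f n + ∑ n ∈ Ico m (M + 1), ((n : ℝ) - m) ^ 2 * f n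
      ≤ 96 / f m ^ 2 + 96 / f m ^ 2 := add_le_add (hL.trans hleft) (hR ▸ hright)
    _ = 192 / f m ^ 2 := by ring

/-- **Anti-concentration for `PF₂` probability sequences**: if `Σ_{n ≤ M} f n = 1` (support in `[0,M]`)
and `m` is a maximiser, then `(f m)² · Var ≤ 192` with `Var = Σ n² f n − (Σ n f n)²`; i.e. the largest
atom is at most `√192 · Var^{−1/2}` — a WEAK FORM (constant `192` in place of `1`) of
`M(X) ≤ 2/√(1 + 4 Var X)` for discrete log-concave `X`.
[cite: BobkovMarsigliettiMelbourne2021, Thm 1.1 (upper bound; weak form with constant 192, our elementary proof)] -/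
theorem sq_mul_variance_le (hf : IsLogConcaveSeq f) {M m : ℕ} (hM : ∀ n, M < n → f n = 0)
    (hm : ∀ n, f n ≤ f m) (hmass : ∑ n ∈ range (M + 1), f n = 1) :
    f m ^ 2 * (∑ n ∈ range (M + 1), (n : ℝ) ^ 2 * f n - (∑ n ∈ range (M + 1), (n : ℝ) * f n) ^ 2) ≤ 192 := by
  rcases (hf.1 m).lt_or_eq with hpos | h0
  · have h := hf.sum_sq_sub_mul_le hM hm hpos hmass.le
    -- `Var = Σ (n−m)² f − (μ − m)² ≤ Σ (n−m)² f`
    have hvar : ∑ n ∈ range (M + 1), (n : ℝ) ^ 2 * f n - (∑ n ∈ range (M + 1), (n : ℝ) * f n) ^ 2 =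
        ∑ n ∈ range (M + 1), ((n : ℝ) - m) ^ 2 * f n -
          (∑ n ∈ range (M + 1), (n : ℝ) * f n - m) ^ 2 := by
      have e : ∑ n ∈ range (M + 1), ((n : ℝ) - m) ^ 2 * f n =
          ∑ n ∈ range (M + 1), (n : ℝ) ^ 2 * f n - 2 * m * ∑ n ∈ range (M + 1), (n : ℝ) * f n +
            (m : ℝ) ^ 2 * ∑ n ∈ range (M + 1), f n := by
        rw [mul_sum, mul_sum, ← sum_sub_distrib, ← sum_add_distrib]
        exact sum_congr rfl fun n _ => by ring
      rw [e, hmass]; ring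
    rw [hvar]
    have hsq : 0 ≤ (∑ n ∈ range (M + 1), (n : ℝ) * f n - m) ^ 2 := sq_nonneg _
    calc f m ^ 2 * (∑ n ∈ range (M + 1), ((n : ℝ) - m) ^ 2 * f n - (∑ n ∈ range (M + 1), (n : ℝ) * f n - m) ^ 2)
        ≤ f m ^ 2 * (192 / f m ^ 2) := by
          refine mul_le_mul_of_nonneg_left ?_ (sq_nonneg _); linarith
      _ = 192 := by field_simp
  · rw [← h0]; norm_num

end IsLogConcaveSeq

/-! ## §4 Poisson-binomial laws: mode probability and first-difference variation are `O(V^{-1/2})` -/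

namespace PoissonBinomial

/-- A Poisson-binomial law attains its maximum on `[0, N]` (`N` = number of parameters): there is a
maximiser `m ≤ N` with `q_i ≤ q_m` for ALL `i`. [cite: Lange2010, §1.7 eq. (1.4)] -/
theorem exists_argmax_pmf (ps : List ℝ) (hps : ∀ p ∈ ps, 0 ≤ p ∧ p ≤ 1) :
    ∃ m, m ≤ ps.length ∧ ∀ i, pmf ps i ≤ pmf ps m := by
  obtain ⟨m, hm, hmax⟩ := exists_max_image (range (ps.length + 1)) (pmf ps) ⟨0, by simp⟩
  refine ⟨m, Nat.lt_succ_iff.1 (mem_range.1 hm), fun i => ?_⟩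
  by_cases hi : i ≤ ps.length
  · exact hmax i (mem_range.2 (Nat.lt_succ_iff.2 hi))
  · rw [pmf_eq_zero_of_length_lt ps i (by omega)]; exact pmf_nonneg ps hps m

/-- **Anti-concentration of a Poisson-binomial law**: every atom satisfies `q_i² · V ≤ 192` with
`V = Σ_k p_k (1 − p_k)` the variance. [cite: RollinRoss2010, §3 (Lemma 3.5 there: the sharp form via Mattner–Roos)] -/
theorem pmf_sq_mul_variance_le (ps : List ℝ) (hps : ∀ p ∈ ps, 0 ≤ p ∧ p ≤ 1) (i : ℕ) :
    pmf ps i ^ 2 * (ps.map fun p => p * (1 - p)).sum ≤ 192 := by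
  obtain ⟨m, hmN, hm⟩ := exists_argmax_pmf ps hps
  have hV := variance_pmf ps
  have h := (isLogConcaveSeq_pmf ps hps).sq_mul_variance_le (M := ps.length)
    (fun n hn => pmf_eq_zero_of_length_lt ps n hn) hm (sum_pmf ps)
  rw [hV] at h
  have hV0 : 0 ≤ (ps.map fun p => p * (1 - p)).sum := by
    refine List.sum_nonneg ?_
    intro x hx
    obtain ⟨p, hp, rfl⟩ := List.mem_map.1 hx
    have := hps p hp
    exact mul_nonneg this.1 (by linarith [this.2])
  calc pmf ps i ^ 2 * (ps.map fun p => p * (1 - p)).sum ≤ pmf ps m ^ 2 * (ps.map fun p => p * (1 - p)).sum :=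
        mul_le_mul_of_nonneg_right (pow_le_pow_left₀ (pmf_nonneg ps hps i) (hm i) 2) hV0
    _ ≤ 192 := h

/-- **Mode bound**: if `V = Σ_k p_k(1 − p_k) > 0` then `q_i ≤ √192 / √V` for every `i`.
[cite: RollinRoss2010, §3 (Lemma 3.5)] -/
theorem pmf_le_of_variance (ps : List ℝ) (hps : ∀ p ∈ ps, 0 ≤ p ∧ p ≤ 1)
    (hV : 0 < (ps.map fun p => p * (1 - p)).sum) (i : ℕ) :
    pmf ps i ≤ Real.sqrt 192 / Real.sqrt ((ps.map fun p => p * (1 - p)).sum) := by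
  have h := pmf_sq_mul_variance_le ps hps i
  have h0 := pmf_nonneg ps hps i
  rw [le_div_iff₀ (Real.sqrt_pos.2 hV), ← Real.sqrt_sq h0, ← Real.sqrt_mul (sq_nonneg _)]
  exact Real.sqrt_le_sqrt h

/-- **Total variation of the first difference of a Poisson-binomial law** equals twice the mode
probability: `q_0 + Σ_{i ≤ N} |q_{i+1} − q_i| = 2 · max_i q_i`. [cite: RollinRoss2010, §3 (the measure `D_1`)] -/
theorem tv_pmf_eq_two_mul (ps : List ℝ) (hps : ∀ p ∈ ps, 0 ≤ p ∧ p ≤ 1) {m : ℕ} (hm : ∀ i, pmf ps i ≤ pmf ps m) :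
    pmf ps 0 + ∑ i ∈ range (ps.length + 1), |pmf ps (i + 1) - pmf ps i| = 2 * pmf ps m :=
  (isLogConcaveSeq_pmf ps hps).sum_abs_sub_eq_two_mul (fun n hn => pmf_eq_zero_of_length_lt ps n hn) hm

/-- **`D_1` of a Poisson-binomial law is `O(V^{-1/2})`**: `q_0 + Σ_{i ≤ N} |q_{i+1} − q_i| ≤ 2√192/√V`
for `V = Σ_k p_k(1−p_k) > 0`. [cite: RollinRoss2010, §3 (Lemma 3.5) and §4.1] -/
theorem tv_pmf_le_of_variance (ps : List ℝ) (hps : ∀ p ∈ ps, 0 ≤ p ∧ p ≤ 1)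
    (hV : 0 < (ps.map fun p => p * (1 - p)).sum) :
    pmf ps 0 + ∑ i ∈ range (ps.length + 1), |pmf ps (i + 1) - pmf ps i| ≤
      2 * (Real.sqrt 192 / Real.sqrt ((ps.map fun p => p * (1 - p)).sum)) := by
  obtain ⟨m, _, hm⟩ := exists_argmax_pmf ps hps
  rw [tv_pmf_eq_two_mul ps hps hm]
  exact mul_le_mul_of_nonneg_left (pmf_le_of_variance ps hps hV m) zero_le_two

/-- The trivial bound `q_0 + Σ_{i ≤ N} |q_{i+1} − q_i| ≤ 2` (no variance needed).
[cite: RollinRoss2010, §3] -/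
theorem tv_pmf_le_two (ps : List ℝ) (hps : ∀ p ∈ ps, 0 ≤ p ∧ p ≤ 1) :
    pmf ps 0 + ∑ i ∈ range (ps.length + 1), |pmf ps (i + 1) - pmf ps i| ≤ 2 := by
  obtain ⟨m, hmN, hm⟩ := exists_argmax_pmf ps hps
  rw [tv_pmf_eq_two_mul ps hps hm]
  have : pmf ps m ≤ 1 := by
    have h := sum_pmf ps
    rw [← h]
    exact single_le_sum (fun i _ => pmf_nonneg ps hps i) (mem_range.2 (Nat.lt_succ_iff.2 hmN))
  linarith

end PoissonBinomial

end Literature.Probability.Distributions
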